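import Literature.Analysis.FluidPDE.PassiveVectorTensorEnergyStability
import HarnessLib

/-!
# Energy-class stability under a STREAM-POTENTIAL perturbation of the carrier
# (constant coercive viscosity tensor; the K1L tail estimate, antisymmetric-potential form)

Analysis/FluidPDE proof-support file (everything proved; no definitions, no named facts). Sequel of
`PassiveVectorTensorEnergyStability`: two weak solutions `w` (carrier `b`) and `u` (carrier `b'`) of
Frisch's anisotropic-eddy-viscosity passive-vector equation (9.57) with `A = 0`, the same constant
tensor in a Legendre–Hadamard window `NearIso 𝔸 lo hi`, `0 < lo`, and the same datum, whose carriers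
differ by the divergence of a bounded ANTISYMMETRIC potential, `b − b' = ∇·ψ` (in distributions at
a.e. time, `ψᵢₐ = −ψₐᵢ`, `|ψᵢₐ| ≤ Λ`), satisfy for a.e. `t ∈ (0,T)`

  `∫ ‖w(t) − u(t)‖² ≤ (d² Λ² / (2 lo)) ∫₀ᵗ ‖∇u‖₂² ≤ (d² Λ² / (4 lo²)) ∫ ‖w₀‖²`

(`ae_integral_norm_sq_sub_le_of_stream`, `…_of_stream_datum`, drop form
`ae_integral_norm_sq_le_add_of_stream`). The carrier difference enters ONLY through the size `Λ` of
its potential: one derivative is moved from `∇·ψ` onto the solution and the Galerkin test field, and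
the Hessian term dies against the antisymmetry of `ψ` (`abs_integral_inner_convect_le_of_stream`:
`|∫⟪v, ((∇·ψ)·∇)P⟫| ≤ d Λ ‖∇v‖₂ ‖∇P‖₂`, proved by truncating `v`, for which `‖∇P_K v‖₂ ≤ ‖∇v‖₂`,
and letting `K → ∞`). In the K1L tail step (`stub_tailL`, cell `ad-ideate`) `Λ = ‖ψ_{>j}‖_∞` is the
stream bivector of the omitted levels and `lo = kbar_j`, so the smallness ratio is exactly the
docstring's `‖ψ_{>j}‖_∞ / kbar_j`.

## Mathlib / tree search

Tree: `PassiveVectorTensorEnergyStability` (Galerkin identity of the difference, coercivity,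
integrability), `PassiveVectorGalerkinIdentity` (dictionary, remainder, Cauchy–Schwarz bound),
`TorusCalculusProofs` (`partialDeriv_inner`), `TorusEnstrophyOrthogonality` (`partialDeriv_comm`,
`convect_eq_sum_smul_partialDeriv`), `TorusTruncationH1`/`PassiveVectorTensorGalerkinTail`
(`eGradNormSq_fourierTruncate_le`). DiPerna–Lions 1989 §II.1 (commutators with the transporting
field); Robinson–Rodrigo–Sadowski 2016 §4.1–§4.2.

## References

* R. J. DiPerna, P.-L. Lions, Invent. Math. 98 (1989), §II.1 Thm. II.1, Lemma II.1. [`DiPernaLions1989`]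
* J. C. Robinson, J. L. Rodrigo, W. Sadowski, *The three-dimensional Navier–Stokes equations*,
  CUP 2016, §4.1 Lemma 4.1, §4.2 (4.20). [`RobinsonRodrigoSadowski2016`]
* U. Frisch, *Turbulence* (CUP 1995), §9.6.3 eq. (9.57) p. 233. [`Frisch1995Turbulence`]
* M. Giaquinta, *Multiple integrals in the calculus of variations* (Princeton 1983), Ch. III §2 (2.2).
  [`Giaquinta1983MultipleIntegrals`]
-/

noncomputable section

open MeasureTheory Set Filter Function TopologicalSpace Complex UnitAddTorus
open scoped ENNReal NNReal InnerProductSpace ComplexConjugate Topology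

namespace Literature.Analysis.FluidPDE

namespace Torus

variable {d : Type*} [Fintype d] [DecidableEq d]

/-! ## The stream (antisymmetric potential) form of the carrier perturbation -/

section StreamHelpers

omit [DecidableEq d] in
/-- A real trigonometric polynomial as the sum of its single real modes. [folklore] -/
private theorem realTrigPoly_eq_sum_singleton₈ (S : Finset (d → ℤ)) (c : (d → ℤ) → EuclideanSpace ℂ d) :
    FunctionSpaces.Torus.realTrigPoly S c = fun y => ∑ k ∈ S,
      (1 : ℝ) • FunctionSpaces.Torus.realTrigPoly {k} c y := by
  funext y
  rw [FunctionSpaces.Torus.realTrigPoly_apply_eq_sum]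
  refine Finset.sum_congr rfl fun k _ => ?_
  rw [one_smul, FunctionSpaces.Torus.realTrigPoly_apply_eq_sum, Finset.sum_singleton]

omit [DecidableEq d] in
/-- An antisymmetric matrix contracted with a symmetric one vanishes. [folklore] -/
private theorem sum_antisymm_mul_symm₈ (ψ H : d → d → ℝ) (hψ : ∀ i a, ψ i a = -ψ a i)
    (hH : ∀ i a, H i a = H a i) : ∑ i, ∑ a, ψ i a * H i a = 0 := by
  have h1 : ∀ i a, ψ i a * H i a = -(ψ a i * H a i) := fun i a => by rw [hψ i a, hH i a]; ring
  have h2 : ∑ i, ∑ a, ψ i a * H i a = -∑ i, ∑ a, ψ i a * H i a := by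
    conv_lhs => rw [Finset.sum_comm]
    rw [Finset.sum_congr rfl fun a _ => Finset.sum_congr rfl fun i _ => h1 i a]
    simp only [Finset.sum_neg_distrib]
  linarith

omit [DecidableEq d] in
/-- `(∑ᵢ xᵢ)(∑ₐ yₐ) ≤ d √(∑ xᵢ²) √(∑ yₐ²)` for nonnegative families. [folklore] -/
private theorem sum_mul_sum_le_card₈ (x y : d → ℝ) (hy : ∀ a, 0 ≤ y a) :
    (∑ i, x i) * ∑ a, y a ≤ Fintype.card d * (Real.sqrt (∑ i, x i ^ 2) * Real.sqrt (∑ a, y a ^ 2)) := by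
  have hX : ∑ i, x i ≤ Real.sqrt (Fintype.card d) * Real.sqrt (∑ i, x i ^ 2) := by
    rw [← Real.sqrt_mul (Nat.cast_nonneg _), ← Finset.card_univ]
    refine Real.le_sqrt_of_sq_le ?_
    exact sq_sum_le_card_mul_sum_sq
  have hY : ∑ a, y a ≤ Real.sqrt (Fintype.card d) * Real.sqrt (∑ a, y a ^ 2) := by
    rw [← Real.sqrt_mul (Nat.cast_nonneg _), ← Finset.card_univ]
    refine Real.le_sqrt_of_sq_le ?_
    exact sq_sum_le_card_mul_sum_sq
  calc (∑ i, x i) * ∑ a, y a ≤ (Real.sqrt (Fintype.card d) * Real.sqrt (∑ i, x i ^ 2)) *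
        (Real.sqrt (Fintype.card d) * Real.sqrt (∑ a, y a ^ 2)) :=
        mul_le_mul hX hY (Finset.sum_nonneg fun a _ => hy a) (by positivity)
    _ = Real.sqrt (Fintype.card d) * Real.sqrt (Fintype.card d) * (Real.sqrt (∑ i, x i ^ 2) * Real.sqrt (∑ a, y a ^ 2)) := by
        ring
    _ = Fintype.card d * (Real.sqrt (∑ i, x i ^ 2) * Real.sqrt (∑ a, y a ^ 2)) := by
        rw [Real.mul_self_sqrt (Nat.cast_nonneg _)]

omit [Fintype d] [DecidableEq d] in
/-- Cauchy–Schwarz for `∫ √f √g` with nonnegative integrable `f`, `g`. [folklore] -/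
private theorem integral_sqrt_mul_sqrt_le₈ {α : Type*} [MeasurableSpace α] {μ : Measure α} {f g : α → ℝ}
    (hf : Integrable f μ) (hg : Integrable g μ) (hf0 : 0 ≤ᵐ[μ] f) (hg0 : 0 ≤ᵐ[μ] g) :
    ∫ x, Real.sqrt (f x) * Real.sqrt (g x) ∂μ ≤ Real.sqrt (∫ x, f x ∂μ) * Real.sqrt (∫ x, g x ∂μ) := by
  have hmem : ∀ {φ : α → ℝ}, Integrable φ μ → 0 ≤ᵐ[μ] φ →
      MemLp (fun x => Real.sqrt (φ x)) (ENNReal.ofReal 2) μ := by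
    intro φ hφ hφ0
    rw [show ENNReal.ofReal 2 = 2 by simp]
    refine (memLp_two_iff_integrable_sq (Real.continuous_sqrt.comp_aestronglyMeasurable hφ.1)).2 ?_
    refine hφ.congr ?_
    filter_upwards [hφ0] with x hx
    rw [Real.sq_sqrt hx]
  have h := integral_mul_le_Lp_mul_Lq_of_nonneg Real.HolderConjugate.two_two
    (ae_of_all _ fun x => Real.sqrt_nonneg (f x)) (ae_of_all _ fun x => Real.sqrt_nonneg (g x)) (hmem hf hf0) (hmem hg hg0)
  have e1 : ∫ x, Real.sqrt (f x) ^ (2 : ℝ) ∂μ = ∫ x, f x ∂μ := by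
    refine integral_congr_ae ?_
    filter_upwards [hf0] with x hx
    rw [Real.rpow_two, Real.sq_sqrt hx]
  have e2 : ∫ x, Real.sqrt (g x) ^ (2 : ℝ) ∂μ = ∫ x, g x ∂μ := by
    refine integral_congr_ae ?_
    filter_upwards [hg0] with x hx
    rw [Real.rpow_two, Real.sq_sqrt hx]
  rw [e1, e2] at h
  simpa [Real.sqrt_eq_rpow] using h

omit [Fintype d] [DecidableEq d] in
/-- `√f √g` is integrable for nonnegative integrable `f`, `g`. [folklore] -/
private theorem integrable_sqrt_mul_sqrt₈ {α : Type*} [MeasurableSpace α] {μ : Measure α} {f g : α → ℝ}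
    (hf : Integrable f μ) (hg : Integrable g μ) (hf0 : ∀ x, 0 ≤ f x) (hg0 : ∀ x, 0 ≤ g x) :
    Integrable (fun x => Real.sqrt (f x) * Real.sqrt (g x)) μ := by
  have hm : AEStronglyMeasurable (fun x => Real.sqrt (f x) * Real.sqrt (g x)) μ :=
    (Real.continuous_sqrt.comp_aestronglyMeasurable hf.1).mul (Real.continuous_sqrt.comp_aestronglyMeasurable hg.1)
  refine Integrable.mono' ((hf.add hg).div_const 2) hm (ae_of_all _ fun x => ?_)
  rw [Real.norm_eq_abs, abs_of_nonneg (mul_nonneg (Real.sqrt_nonneg _) (Real.sqrt_nonneg _)), Pi.add_apply]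
  nlinarith [Real.sq_sqrt (hf0 x), Real.sq_sqrt (hg0 x), sq_nonneg (Real.sqrt (f x) - Real.sqrt (g x))]

omit [Fintype d] [DecidableEq d] in
/-- Absorption: `S + 2 lo G ≤ 2 a √G` with `G ≥ 0`, `lo > 0` forces `S ≤ a²/(2 lo)`. [folklore] -/
private theorem le_of_absorb₈ {lo S G a : ℝ} (hlo : 0 < lo) (hG : 0 ≤ G)
    (h : S + 2 * lo * G ≤ 2 * a * Real.sqrt G) : S ≤ a ^ 2 / (2 * lo) := by
  set r := Real.sqrt G with hr
  have hGr : G = r ^ 2 := (Real.sq_sqrt hG).symm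
  rw [hGr] at h
  rw [le_div_iff₀ (by positivity)]
  nlinarith [sq_nonneg (a - 2 * lo * r), mul_le_mul_of_nonneg_left h (by positivity : (0 : ℝ) ≤ 2 * lo)]

omit [Fintype d] [DecidableEq d] in
/-- Cauchy–Schwarz for pairings of `L²` fields: `|∫ ⟪a, w⟫| ≤ √(∫ ‖a‖²) · √(∫ ‖w‖²)`. [folklore] -/
private theorem abs_integral_inner_le_sqrt_mul_sqrt₈ {α : Type*} [MeasurableSpace α] {μ : Measure α}
    {E : Type*} [NormedAddCommGroup E] [InnerProductSpace ℝ E] {a z : α → E} (ha : MemLp a 2 μ) (hz : MemLp z 2 μ) :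
    |∫ x, ⟪a x, z x⟫_ℝ ∂μ| ≤ Real.sqrt (∫ x, ‖a x‖ ^ 2 ∂μ) * Real.sqrt (∫ x, ‖z x‖ ^ 2 ∂μ) := by
  have h1 : |∫ x, ⟪a x, z x⟫_ℝ ∂μ| ≤ ∫ x, ‖a x‖ * ‖z x‖ ∂μ := by
    rw [← Real.norm_eq_abs]
    refine (norm_integral_le_integral_norm _).trans (integral_mono_of_nonneg
      (ae_of_all _ fun x => norm_nonneg _) (ha.norm.integrable_mul hz.norm)
      (ae_of_all _ fun x => norm_inner_le_norm _ _))
  have h2 := integral_mul_le_Lp_mul_Lq_of_nonneg Real.HolderConjugate.two_two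
    (ae_of_all _ fun x => norm_nonneg (a x)) (ae_of_all _ fun x => norm_nonneg (z x))
    (by simpa using ha.norm) (by simpa using hz.norm)
  refine h1.trans (h2.trans_eq ?_)
  simp only [Real.rpow_two, Real.sqrt_eq_rpow]

/-- **The cross flux against a stream potential.** Let `c = ∇·ψ` in distributions with `ψ`
antisymmetric, `|ψᵢₐ| ≤ Λ`, `‖c‖ ≤ C` a.e.; let `v ∈ L²` with finite enstrophy `‖∇v‖₂² < ∞` and `P`
smooth. Then `|∫⟪v, (c·∇)P⟫| ≤ d Λ ‖∇v‖₂ ‖∇P‖₂` — one derivative is moved from `c` onto `v` and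
`P`, the Hessian of `P` dies against the antisymmetry of `ψ` (approximate `v` by its truncations
`P_K v`, for which `‖∇P_K v‖₂ ≤ ‖∇v‖₂`, and let `K → ∞`; the remainder is `O(C ‖v − P_K v‖₂ ‖∇P‖₂)`).
[cite: DiPernaLions1989, §II.1 Thm. II.1 (commutator with the transporting field)]
[cite: RobinsonRodrigoSadowski2016, §4.1 (Lemma 4.1)] -/
theorem abs_integral_inner_convect_le_of_stream {c v : UnitAddTorus d → EuclideanSpace ℝ d}
    (hv2 : MemLp v 2 volume) {C : ℝ} (hC : 0 ≤ C) (hcC : ∀ᵐ x ∂volume, ‖c x‖ ≤ C)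
    (hcm : AEStronglyMeasurable c volume)
    {ψ : UnitAddTorus d → d → d → ℝ} (hanti : ∀ x i a, ψ x i a = -ψ x a i) {Λ : ℝ} (hΛ : 0 ≤ Λ)
    (hψΛ : ∀ᵐ x ∂volume, ∀ i a, |ψ x i a| ≤ Λ) (hψm : ∀ i a, AEStronglyMeasurable (fun x => ψ x i a) volume)
    (hdiv : ∀ φ : UnitAddTorus d → ℝ, FunctionSpaces.Torus.IsSmooth φ → ∀ a,
      ∫ x, c x a * φ x = -∫ x, ∑ i, ψ x i a * FunctionSpaces.Torus.partialDeriv i φ x)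
    {P : UnitAddTorus d → EuclideanSpace ℝ d} (hP : FunctionSpaces.Torus.IsSmooth P)
    (hfin : FunctionSpaces.Torus.eGradNormSq v ≠ ⊤) :
    |∫ x, ⟪v x, FunctionSpaces.Torus.convect c P x⟫_ℝ| ≤
      Fintype.card d * Λ * Real.sqrt ((FunctionSpaces.Torus.eGradNormSq v).toReal) *
        Real.sqrt (FunctionSpaces.Torus.gradNormSq P) := by
  have hvi : Integrable v volume := hv2.integrable one_le_two
  have hP1 : FunctionSpaces.Torus.IsContDiff 1 P := hP.isContDiff (by simp)
  -- components of `c` and products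
  have hcmj : ∀ j, AEStronglyMeasurable (fun x => c x j) volume := fun j =>
    (PiLp.continuous_apply 2 (fun _ : d => ℝ) j).comp_aestronglyMeasurable hcm
  have hcCj : ∀ j, ∀ᵐ x ∂volume, ‖c x j‖ ≤ C := fun j => by
    filter_upwards [hcC] with x hx
    exact (PiLp.norm_apply_le (c x) j).trans hx
  have hsmul : ∀ {g : UnitAddTorus d → EuclideanSpace ℝ d}, Integrable g volume →
      ∀ j, Integrable (fun x => c x j • g x) volume := fun hg j => hg.bdd_smul C (hcmj j) (hcCj j)
  -- the bound for every truncation level `K`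
  set D : ℝ := (FunctionSpaces.Torus.eGradNormSq v).toReal with hD
  have hK : ∀ K : ℕ, |∫ x, ⟪v x, FunctionSpaces.Torus.convect c P x⟫_ℝ| ≤
      Fintype.card d * C * Real.sqrt (∫ x, ‖v x - FunctionSpaces.Torus.fourierTruncate K v x‖ ^ 2) *
          Real.sqrt (FunctionSpaces.Torus.gradNormSq P) +
        Fintype.card d * Λ * Real.sqrt D * Real.sqrt (FunctionSpaces.Torus.gradNormSq P) := by
    intro K
    set U : UnitAddTorus d → EuclideanSpace ℝ d := FunctionSpaces.Torus.fourierTruncate K v with hU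
    have hUs : FunctionSpaces.Torus.IsSmooth U := FunctionSpaces.Torus.isSmooth_fourierTruncate K v
    have hU1 : FunctionSpaces.Torus.IsContDiff 1 U := hUs.isContDiff (by simp)
    have hUi : Integrable U volume := hUs.integrable
    -- split `v = (v - U) + U`
    have i1 := integrable_inner_convect_of_integrable_smul (u := c) (v := v) (hsmul hvi) hP
    have i2 := integrable_inner_convect_of_integrable_smul (u := c) (v := U) (hsmul hUi) hP
    have i3 := integrable_inner_convect_of_integrable_smul (u := c) (v := fun x => v x - U x)
      (fun j => by
        refine ((hsmul hvi j).sub (hsmul hUi j)).congr (ae_of_all _ fun x => ?_)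
        simp only [Pi.sub_apply]
        rw [smul_sub]) hP
    have hsplit : ∫ x, ⟪v x, FunctionSpaces.Torus.convect c P x⟫_ℝ =
        (∫ x, ⟪v x - U x, FunctionSpaces.Torus.convect c P x⟫_ℝ) + ∫ x, ⟪U x, FunctionSpaces.Torus.convect c P x⟫_ℝ := by
      rw [← integral_add i3 i2]
      refine integral_congr_ae (ae_of_all _ fun x => ?_)
      dsimp only
      rw [inner_sub_left]
      ring
    -- the remainder term
    have hT1 := abs_integral_inner_convect_le_of_norm_le (u := c) (hv2.sub (FunctionSpaces.Torus.memLp_fourierTruncate K v 2))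
      hC hcC hP
    -- the smooth term: move the derivative onto `U` and `P`
    set φ : d → UnitAddTorus d → ℝ := fun a x => ⟪U x, FunctionSpaces.Torus.partialDeriv a P x⟫_ℝ with hφ
    have hφs : ∀ a, FunctionSpaces.Torus.IsSmooth (φ a) := fun a => hUs.inner (hP.partialDeriv a)
    have hT2eq : ∫ x, ⟪U x, FunctionSpaces.Torus.convect c P x⟫_ℝ = ∑ a, ∫ x, c x a * φ a x := by
      rw [← integral_finsetSum _ (fun a _ => Integrable.bdd_mul (c := C) (hφs a).integrable (hcmj a) (hcCj a))]
      refine integral_congr_ae (ae_of_all _ fun x => ?_)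
      dsimp only
      rw [FunctionSpaces.Torus.convect_eq_sum_smul_partialDeriv hP1 x, inner_sum]
      refine Finset.sum_congr rfl fun a _ => ?_
      rw [inner_smul_right, hφ]
    have hT2 : ∫ x, ⟪U x, FunctionSpaces.Torus.convect c P x⟫_ℝ =
        -∫ x, ∑ a, ∑ i, ψ x i a * ⟪FunctionSpaces.Torus.partialDeriv i U x, FunctionSpaces.Torus.partialDeriv a P x⟫_ℝ := by
      rw [hT2eq]
      have hda : ∀ a, ∫ x, c x a * φ a x =
          -∫ x, ∑ i, ψ x i a * FunctionSpaces.Torus.partialDeriv i (φ a) x := fun a => hdiv (φ a) (hφs a) a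
      simp_rw [hda]
      rw [Finset.sum_neg_distrib, ← integral_finsetSum _ (fun a _ => ?_)]
      · congr 1
        refine integral_congr_ae ?_
        refine ae_of_all _ fun x => ?_
        dsimp only
        -- expand the derivatives of `φ a` and kill the Hessian term by antisymmetry
        have hexp : ∀ a i, FunctionSpaces.Torus.partialDeriv i (φ a) x =
            ⟪U x, FunctionSpaces.Torus.partialDeriv i (FunctionSpaces.Torus.partialDeriv a P) x⟫_ℝ +
              ⟪FunctionSpaces.Torus.partialDeriv i U x, FunctionSpaces.Torus.partialDeriv a P x⟫_ℝ := by
          intro a i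
          rw [hφ]
          exact FunctionSpaces.Torus.partialDeriv_inner hU1 ((hP.partialDeriv a).isContDiff (by simp)) i x
        simp_rw [hexp, mul_add, Finset.sum_add_distrib]
        have h0 : ∑ a, ∑ i, ψ x i a *
            ⟪U x, FunctionSpaces.Torus.partialDeriv i (FunctionSpaces.Torus.partialDeriv a P) x⟫_ℝ = 0 := by
          rw [Finset.sum_comm]
          exact sum_antisymm_mul_symm₈ (ψ x) _ (hanti x) fun i a => by
            rw [FunctionSpaces.Torus.partialDeriv_comm hP i a x]
        rw [h0, zero_add]
      · refine integrable_finsetSum _ fun i _ => ?_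
        exact Integrable.bdd_mul (c := Λ) ((hφs a).partialDeriv i).integrable (hψm i a) (by
          filter_upwards [hψΛ] with x hx
          rw [Real.norm_eq_abs]
          exact hx i a)
    -- bound the smooth term
    have hT2b : |∫ x, ⟪U x, FunctionSpaces.Torus.convect c P x⟫_ℝ| ≤
        Fintype.card d * Λ * Real.sqrt (FunctionSpaces.Torus.gradNormSq U) * Real.sqrt (FunctionSpaces.Torus.gradNormSq P) := by
      rw [hT2, abs_neg]
      set F : UnitAddTorus d → ℝ := fun x => ∑ i, ‖FunctionSpaces.Torus.partialDeriv i U x‖ ^ 2 with hF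
      set G : UnitAddTorus d → ℝ := fun x => ∑ a, ‖FunctionSpaces.Torus.partialDeriv a P x‖ ^ 2 with hG
      have hFi : Integrable F volume := integrable_finsetSum _ fun i _ => ((hUs.partialDeriv i).norm_sq).integrable
      have hGi : Integrable G volume := integrable_finsetSum _ fun a _ => ((hP.partialDeriv a).norm_sq).integrable
      have hF0 : ∀ x, 0 ≤ F x := fun x => Finset.sum_nonneg fun i _ => sq_nonneg _
      have hG0 : ∀ x, 0 ≤ G x := fun x => Finset.sum_nonneg fun a _ => sq_nonneg _
      have hpt : ∀ᵐ x ∂volume, |∑ a, ∑ i, ψ x i a *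
          ⟪FunctionSpaces.Torus.partialDeriv i U x, FunctionSpaces.Torus.partialDeriv a P x⟫_ℝ| ≤
          Λ * (Fintype.card d * (Real.sqrt (F x) * Real.sqrt (G x))) := by
        filter_upwards [hψΛ] with x hx
        calc |∑ a, ∑ i, ψ x i a * ⟪FunctionSpaces.Torus.partialDeriv i U x, FunctionSpaces.Torus.partialDeriv a P x⟫_ℝ|
            ≤ ∑ a, ∑ i, |ψ x i a * ⟪FunctionSpaces.Torus.partialDeriv i U x, FunctionSpaces.Torus.partialDeriv a P x⟫_ℝ| :=
              (Finset.abs_sum_le_sum_abs _ _).trans (Finset.sum_le_sum fun a _ => Finset.abs_sum_le_sum_abs _ _)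
          _ ≤ ∑ a, ∑ i, Λ * (‖FunctionSpaces.Torus.partialDeriv i U x‖ * ‖FunctionSpaces.Torus.partialDeriv a P x‖) := by
              refine Finset.sum_le_sum fun a _ => Finset.sum_le_sum fun i _ => ?_
              rw [abs_mul]
              exact mul_le_mul (hx i a) (abs_real_inner_le_norm _ _) (abs_nonneg _) hΛ
          _ = Λ * ((∑ i, ‖FunctionSpaces.Torus.partialDeriv i U x‖) * ∑ a, ‖FunctionSpaces.Torus.partialDeriv a P x‖) := by
              rw [Finset.sum_mul_sum, Finset.sum_comm, Finset.mul_sum]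
              refine Finset.sum_congr rfl fun i _ => ?_
              rw [Finset.mul_sum]
          _ ≤ Λ * (Fintype.card d * (Real.sqrt (F x) * Real.sqrt (G x))) :=
              mul_le_mul_of_nonneg_left (sum_mul_sum_le_card₈ _ _ (fun a => norm_nonneg _)) hΛ
      have hIi : Integrable (fun x => ∑ a, ∑ i, ψ x i a *
          ⟪FunctionSpaces.Torus.partialDeriv i U x, FunctionSpaces.Torus.partialDeriv a P x⟫_ℝ) volume := by
        refine integrable_finsetSum _ fun a _ => integrable_finsetSum _ fun i _ => ?_
        exact Integrable.bdd_mul (c := Λ) (((hUs.partialDeriv i).inner (hP.partialDeriv a))).integrable (hψm i a) (by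
          filter_upwards [hψΛ] with x hx
          rw [Real.norm_eq_abs]
          exact hx i a)
      have hsg : Integrable (fun x => Real.sqrt (F x) * Real.sqrt (G x)) volume :=
        integrable_sqrt_mul_sqrt₈ hFi hGi hF0 hG0
      calc |∫ x, ∑ a, ∑ i, ψ x i a * ⟪FunctionSpaces.Torus.partialDeriv i U x, FunctionSpaces.Torus.partialDeriv a P x⟫_ℝ|
          ≤ ∫ x, |∑ a, ∑ i, ψ x i a * ⟪FunctionSpaces.Torus.partialDeriv i U x, FunctionSpaces.Torus.partialDeriv a P x⟫_ℝ| :=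
            abs_integral_le_integral_abs
        _ ≤ ∫ x, Λ * (Fintype.card d * (Real.sqrt (F x) * Real.sqrt (G x))) :=
            integral_mono_ae hIi.abs ((hsg.const_mul _).const_mul _) hpt
        _ = Λ * (Fintype.card d * ∫ x, Real.sqrt (F x) * Real.sqrt (G x)) := by
            rw [integral_const_mul, integral_const_mul]
        _ ≤ Λ * (Fintype.card d * (Real.sqrt (∫ x, F x) * Real.sqrt (∫ x, G x))) :=
            mul_le_mul_of_nonneg_left (mul_le_mul_of_nonneg_left
              (integral_sqrt_mul_sqrt_le₈ hFi hGi (ae_of_all _ hF0) (ae_of_all _ hG0)) (Nat.cast_nonneg _)) hΛ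
        _ = Fintype.card d * Λ * Real.sqrt (FunctionSpaces.Torus.gradNormSq U) * Real.sqrt (FunctionSpaces.Torus.gradNormSq P) := by
            rw [hF, hG, FunctionSpaces.Torus.gradNormSq, FunctionSpaces.Torus.gradNormSq]
            ring
    -- `‖∇U‖₂ ≤ ‖∇v‖₂`
    have hUD : FunctionSpaces.Torus.gradNormSq U ≤ D := by
      rw [hU, gradNormSq_fourierTruncate, hD]
      exact ENNReal.toReal_mono hfin (Torus.eGradNormSq_fourierTruncate_le hvi K)
    rw [hsplit]
    refine (abs_add_le _ _).trans (add_le_add hT1 (hT2b.trans ?_))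
    exact mul_le_mul_of_nonneg_right (mul_le_mul_of_nonneg_left (Real.sqrt_le_sqrt hUD) (by positivity))
      (Real.sqrt_nonneg _)
  -- let `K → ∞`
  have htail : Tendsto (fun K => ∫ x, ‖v x - FunctionSpaces.Torus.fourierTruncate K v x‖ ^ 2) atTop (𝓝 0) := by
    have ht := FunctionSpaces.Torus.tendsto_lintegral_enorm_sq_fourierTruncate_sub hv2
    have hreal := (ENNReal.tendsto_toReal ENNReal.zero_ne_top).comp ht
    rw [ENNReal.toReal_zero] at hreal
    refine hreal.congr fun K => ?_
    rw [Function.comp_apply, ← integral_toReal]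
    · refine integral_congr_ae (ae_of_all _ fun x => ?_)
      dsimp only
      rw [ENNReal.toReal_pow, toReal_enorm, norm_sub_rev]
    · exact (((FunctionSpaces.Torus.continuous_fourierTruncate K v).aestronglyMeasurable.sub hv2.1).enorm.pow_const 2)
    · exact ae_of_all _ fun x => ENNReal.pow_lt_top enorm_lt_top
  have hlim : Tendsto (fun K : ℕ =>
      Fintype.card d * C * Real.sqrt (∫ x, ‖v x - FunctionSpaces.Torus.fourierTruncate K v x‖ ^ 2) *
          Real.sqrt (FunctionSpaces.Torus.gradNormSq P) +
        Fintype.card d * Λ * Real.sqrt D * Real.sqrt (FunctionSpaces.Torus.gradNormSq P)) atTop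
      (𝓝 (Fintype.card d * C * Real.sqrt 0 * Real.sqrt (FunctionSpaces.Torus.gradNormSq P) +
        Fintype.card d * Λ * Real.sqrt D * Real.sqrt (FunctionSpaces.Torus.gradNormSq P))) :=
    ((((Real.continuous_sqrt.tendsto 0).comp htail).const_mul _).mul_const _).add tendsto_const_nhds
  rw [Real.sqrt_zero, mul_zero, zero_mul, zero_add] at hlim
  exact ge_of_tendsto' hlim hK

end StreamHelpers

section StreamEstimate

namespace IsWeakTensorPassiveVectorOn

variable {T : ℝ} {𝔸 : Visc4 d} {b b' w u : ℝ → UnitAddTorus d → EuclideanSpace ℝ d}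
  {w₀ : UnitAddTorus d → EuclideanSpace ℝ d}

set_option maxHeartbeats 800000 in
/-- **The Galerkin flux of the difference, stream form** (`A = 0`). If `b − b' = ∇·ψ` in
distributions at a.e. time, `ψ` antisymmetric with `|ψᵢₐ| ≤ Λ`, `‖b‖ ≤ M`, `‖b'‖ ≤ M'`, and
`‖∇u(s)‖₂² < ∞` a.e., then for a.e. `s ∈ (0,T)` and every `N` (`z = w − u`, `P = P_N z(s)`):
`∑_{|k|≤N} Re B^{w−u}_k(ẑ(s)(k))(s) ≤ d M (2∫‖w − P_N w‖² + 2∫‖u − P_N u‖²)^{1/2} ‖∇P‖₂ + d Λ ‖∇u(s)‖₂ ‖∇P‖₂`.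
[cite: RobinsonRodrigoSadowski2016, §4.2 (4.20)] [cite: DiPernaLions1989, §II.1 Thm. II.1] -/
theorem ae_fluxSum_sub_le_stream (h₁ : IsWeakTensorPassiveVectorOn 0 T 𝔸 b w₀ w)
    (h₂ : IsWeakTensorPassiveVectorOn 0 T 𝔸 b' w₀ u) {M M' : ℝ} (hM : 0 ≤ M) (hM' : 0 ≤ M')
    (hbM : ∀ᵐ s ∂(volume.restrict (Ioo 0 T)), ∀ᵐ x ∂volume, ‖b s x‖ ≤ M)
    (hbM' : ∀ᵐ s ∂(volume.restrict (Ioo 0 T)), ∀ᵐ x ∂volume, ‖b' s x‖ ≤ M')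
    {ψ : ℝ → UnitAddTorus d → d → d → ℝ} (hanti : ∀ s x i a, ψ s x i a = -ψ s x a i) {Λ : ℝ} (hΛ : 0 ≤ Λ)
    (hψΛ : ∀ᵐ s ∂(volume.restrict (Ioo 0 T)), ∀ᵐ x ∂volume, ∀ i a, |ψ s x i a| ≤ Λ)
    (hψm : ∀ᵐ s ∂(volume.restrict (Ioo 0 T)), ∀ i a, AEStronglyMeasurable (fun x => ψ s x i a) volume)
    (hdivψ : ∀ᵐ s ∂(volume.restrict (Ioo 0 T)), ∀ φ : UnitAddTorus d → ℝ, FunctionSpaces.Torus.IsSmooth φ → ∀ a,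
      ∫ x, (b s x a - b' s x a) * φ x = -∫ x, ∑ i, ψ s x i a * FunctionSpaces.Torus.partialDeriv i φ x)
    (hfin : ∀ᵐ s ∂(volume.restrict (Ioo 0 T)), FunctionSpaces.Torus.eGradNormSq (u s) < ⊤) :
    ∀ᵐ s ∂(volume.restrict (Ioo 0 T)), ∀ N : ℕ,
      ∑ k ∈ FunctionSpaces.Torus.freqBall N,
        ((∑ j, (2 * Real.pi * I * (k j)) *
            ⟪mFourierCoeff (FunctionSpaces.EuclideanSpace.complexify ∘ fun x => b s x j • w s x) k -
              mFourierCoeff (FunctionSpaces.EuclideanSpace.complexify ∘ fun x => b' s x j • u s x) k,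
              mFourierCoeff (FunctionSpaces.EuclideanSpace.complexify ∘ w s) k -
                mFourierCoeff (FunctionSpaces.EuclideanSpace.complexify ∘ u s) k⟫_ℂ) +
          ((0 : ℝ) : ℂ) * ∑ j, (2 * Real.pi * I * (k j)) *
            ⟪mFourierCoeff (FunctionSpaces.EuclideanSpace.complexify ∘ fun x => w s x j • b s x) k -
              mFourierCoeff (FunctionSpaces.EuclideanSpace.complexify ∘ fun x => u s x j • b' s x) k,
              mFourierCoeff (FunctionSpaces.EuclideanSpace.complexify ∘ w s) k -
                mFourierCoeff (FunctionSpaces.EuclideanSpace.complexify ∘ u s) k⟫_ℂ).re ≤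
        Fintype.card d * M *
            Real.sqrt (2 * (∫ x, ‖w s x - FunctionSpaces.Torus.fourierTruncate N (w s) x‖ ^ 2) +
              2 * ∫ x, ‖u s x - FunctionSpaces.Torus.fourierTruncate N (u s) x‖ ^ 2) *
            Real.sqrt (4 * Real.pi ^ 2 * ∑ k ∈ FunctionSpaces.Torus.freqBall N, FunctionSpaces.Torus.freqNormSq k *
              ‖mFourierCoeff (FunctionSpaces.EuclideanSpace.complexify ∘ w s) k -
                mFourierCoeff (FunctionSpaces.EuclideanSpace.complexify ∘ u s) k‖ ^ 2) +
          Fintype.card d * Λ * Real.sqrt ((FunctionSpaces.Torus.eGradNormSq (u s)).toReal) *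
            Real.sqrt (4 * Real.pi ^ 2 * ∑ k ∈ FunctionSpaces.Torus.freqBall N, FunctionSpaces.Torus.freqNormSq k *
              ‖mFourierCoeff (FunctionSpaces.EuclideanSpace.complexify ∘ w s) k -
                mFourierCoeff (FunctionSpaces.EuclideanSpace.complexify ∘ u s) k‖ ^ 2) := by
  filter_upwards [h₁.ae_integrable_slice, h₂.ae_integrable_slice, h₁.ae_memLp_two, h₂.ae_memLp_two,
    h₁.ae_isWeaklyDivFree_carrier, h₁.ae_aestronglyMeasurable_slice, h₂.ae_aestronglyMeasurable_slice, hbM, hbM',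
    hψΛ, hψm, hdivψ, hfin]
    with s hs1 hs2 hm1 hm2 hbdiv hsm1 hsm2 hbs hbs' hψs hψms hdivs hfins
  intro N
  -- ### the difference slice and its truncation
  set v : UnitAddTorus d → EuclideanSpace ℝ d := fun x => w s x - u s x with hv
  have hvi : Integrable v volume := hs1.1.sub hs2.1
  have hv2 : MemLp v 2 volume := hm1.sub hm2
  set c : (d → ℤ) → EuclideanSpace ℂ d := fun k =>
    mFourierCoeff (FunctionSpaces.EuclideanSpace.complexify ∘ w s) k -
      mFourierCoeff (FunctionSpaces.EuclideanSpace.complexify ∘ u s) k with hc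
  have hck : ∀ k, mFourierCoeff (FunctionSpaces.EuclideanSpace.complexify ∘ v) k = c k := by
    intro k
    rw [hv, show (fun x => w s x - u s x) = w s - u s from rfl, FunctionSpaces.Torus.complexify_comp_sub,
      FunctionSpaces.Torus.mFourierCoeff_sub (FunctionSpaces.Torus.integrable_complexify_comp hs1.1)
        (FunctionSpaces.Torus.integrable_complexify_comp hs2.1)]
  set P : UnitAddTorus d → EuclideanSpace ℝ d := FunctionSpaces.Torus.fourierTruncate N v with hP
  have hPs : FunctionSpaces.Torus.IsSmooth P := FunctionSpaces.Torus.isSmooth_fourierTruncate N v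
  have hPc : P = FunctionSpaces.Torus.realTrigPoly (FunctionSpaces.Torus.freqBall N) c := by
    rw [hP, FunctionSpaces.Torus.fourierTruncate_eq]
    congr 1
    funext k
    exact hck k
  -- ### the carriers
  have hbint : Integrable (b s) volume := Integrable.of_bound hsm1.2 M hbs
  have hbmj : ∀ j, AEStronglyMeasurable (fun x => b s x j) volume := fun j =>
    (PiLp.continuous_apply 2 (fun _ : d => ℝ) j).comp_aestronglyMeasurable hsm1.2
  have hbu : ∀ j, Integrable (fun x => b s x j • u s x) volume := by
    intro j
    have h := (hs2.1).bdd_smul M (hbmj j) (by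
      filter_upwards [hbs] with x hx
      exact (PiLp.norm_apply_le (b s x) j).trans hx)
    exact h
  have hbz : ∀ j, Integrable (fun x => b s x j • v x) volume := by
    intro j
    refine ((hs1.2.1 j).sub (hbu j)).congr (ae_of_all _ fun x => ?_)
    simp only [Pi.sub_apply, hv]
    rw [smul_sub]
  have hdbu : ∀ j, Integrable (fun x => (b s x - b' s x) j • u s x) volume := by
    intro j
    refine ((hbu j).sub (hs2.2.1 j)).congr (ae_of_all _ fun x => ?_)
    simp only [Pi.sub_apply, PiLp.sub_apply]
    rw [sub_smul]
  -- ### the Fourier flux sum in physical variables: `I₁ − I₂`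
  have ha : ∀ k : d → ℤ, FunctionSpaces.Torus.IsSmooth (FunctionSpaces.Torus.realTrigPoly {k} c) :=
    fun k => FunctionSpaces.Torus.isSmooth_realTrigPoly _ _
  have e1 : ∫ x, ⟪w s x, FunctionSpaces.Torus.convect (b s) P x⟫_ℝ =
      ∑ k ∈ FunctionSpaces.Torus.freqBall N, (∑ j, (2 * Real.pi * I * (k j)) *
        ⟪mFourierCoeff (FunctionSpaces.EuclideanSpace.complexify ∘ fun x => b s x j • w s x) k, c k⟫_ℂ).re := by
    rw [hPc, realTrigPoly_eq_sum_singleton₈ (FunctionSpaces.Torus.freqBall N) c,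
      ← sum_mul_integral_inner_convect_eq (FunctionSpaces.Torus.freqBall N) (fun _ => (1 : ℝ)) ha hs1.2.1]
    refine Finset.sum_congr rfl fun k _ => ?_
    rw [one_mul, integral_inner_convect_realTrigPoly_singleton hs1.2.1 k c]
  have e2 : ∫ x, ⟪u s x, FunctionSpaces.Torus.convect (b' s) P x⟫_ℝ =
      ∑ k ∈ FunctionSpaces.Torus.freqBall N, (∑ j, (2 * Real.pi * I * (k j)) *
        ⟪mFourierCoeff (FunctionSpaces.EuclideanSpace.complexify ∘ fun x => b' s x j • u s x) k, c k⟫_ℂ).re := by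
    rw [hPc, realTrigPoly_eq_sum_singleton₈ (FunctionSpaces.Torus.freqBall N) c,
      ← sum_mul_integral_inner_convect_eq (FunctionSpaces.Torus.freqBall N) (fun _ => (1 : ℝ)) ha hs2.2.1]
    refine Finset.sum_congr rfl fun k _ => ?_
    rw [one_mul, integral_inner_convect_realTrigPoly_singleton hs2.2.1 k c]
  have hLHS : ∑ k ∈ FunctionSpaces.Torus.freqBall N,
      ((∑ j, (2 * Real.pi * I * (k j)) *
          ⟪mFourierCoeff (FunctionSpaces.EuclideanSpace.complexify ∘ fun x => b s x j • w s x) k -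
            mFourierCoeff (FunctionSpaces.EuclideanSpace.complexify ∘ fun x => b' s x j • u s x) k, c k⟫_ℂ) +
        ((0 : ℝ) : ℂ) * ∑ j, (2 * Real.pi * I * (k j)) *
          ⟪mFourierCoeff (FunctionSpaces.EuclideanSpace.complexify ∘ fun x => w s x j • b s x) k -
            mFourierCoeff (FunctionSpaces.EuclideanSpace.complexify ∘ fun x => u s x j • b' s x) k, c k⟫_ℂ).re =
      (∫ x, ⟪w s x, FunctionSpaces.Torus.convect (b s) P x⟫_ℝ) - ∫ x, ⟪u s x, FunctionSpaces.Torus.convect (b' s) P x⟫_ℝ := by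
    rw [e1, e2, ← Finset.sum_sub_distrib]
    refine Finset.sum_congr rfl fun k _ => ?_
    rw [Complex.ofReal_zero, zero_mul, add_zero, ← Complex.sub_re, ← Finset.sum_sub_distrib]
    congr 1
    refine Finset.sum_congr rfl fun j _ => ?_
    rw [inner_sub_left, mul_sub]
  -- ### the physical split `I₁ − I₂ = I₃ + I₄`
  have i1 := integrable_inner_convect_of_integrable_smul hs1.2.1 hPs
  have i2 := integrable_inner_convect_of_integrable_smul hs2.2.1 hPs
  have i3 := integrable_inner_convect_of_integrable_smul (u := b s) (v := v) hbz hPs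
  have i4 := integrable_inner_convect_of_integrable_smul (u := fun x => b s x - b' s x) (v := u s) hdbu hPs
  have hconv : ∀ x, FunctionSpaces.Torus.convect (fun y => b s y - b' s y) P x =
      FunctionSpaces.Torus.convect (b s) P x - FunctionSpaces.Torus.convect (b' s) P x := fun x => by
    simp [FunctionSpaces.Torus.convect, map_sub]
  have hsplit : (∫ x, ⟪w s x, FunctionSpaces.Torus.convect (b s) P x⟫_ℝ) - ∫ x, ⟪u s x, FunctionSpaces.Torus.convect (b' s) P x⟫_ℝ =
      (∫ x, ⟪v x, FunctionSpaces.Torus.convect (b s) P x⟫_ℝ) +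
        ∫ x, ⟪u s x, FunctionSpaces.Torus.convect (fun y => b s y - b' s y) P x⟫_ℝ := by
    rw [← integral_sub i1 i2, ← integral_add i3 i4]
    refine integral_congr_ae (ae_of_all _ fun x => ?_)
    dsimp only
    rw [hconv x, hv]
    simp only [inner_sub_left, inner_sub_right]
    ring
  -- ### the remainder form of `I₃` and the two bounds
  have hrem : ∫ x, ⟪v x, FunctionSpaces.Torus.convect (b s) P x⟫_ℝ =
      ∫ x, ⟪v x - P x, FunctionSpaces.Torus.convect (b s) P x⟫_ℝ := by
    rw [hP]
    exact integral_inner_convect_fourierTruncate_eq_remainder hbint hbdiv hbz N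
  have hvP : MemLp (fun x => v x - P x) 2 volume := hv2.sub (FunctionSpaces.Torus.memLp_fourierTruncate N v 2)
  have hR := abs_integral_inner_convect_le_of_norm_le (u := b s) hvP hM hbs hPs
  -- the cross flux, stream form
  have hcC : ∀ᵐ x ∂volume, ‖b s x - b' s x‖ ≤ M + M' := by
    filter_upwards [hbs, hbs'] with x h1 h2
    exact (norm_sub_le _ _).trans (add_le_add h1 h2)
  have hdivs' : ∀ φ : UnitAddTorus d → ℝ, FunctionSpaces.Torus.IsSmooth φ → ∀ a,
      ∫ x, (fun y => b s y - b' s y) x a * φ x = -∫ x, ∑ i, ψ s x i a * FunctionSpaces.Torus.partialDeriv i φ x := by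
    intro φ hφ a
    rw [← hdivs φ hφ a]
    rfl
  have hX := abs_integral_inner_convect_le_of_stream (c := fun x => b s x - b' s x) hm2 (add_nonneg hM hM') hcC
    (hsm1.2.sub hsm2.2) (hanti s) hΛ hψs hψms hdivs' hPs hfins.ne
  -- ### `‖∇P‖₂²` in Fourier variables
  have hgrad : FunctionSpaces.Torus.gradNormSq P = 4 * Real.pi ^ 2 * ∑ k ∈ FunctionSpaces.Torus.freqBall N,
      FunctionSpaces.Torus.freqNormSq k * ‖c k‖ ^ 2 := by
    rw [hP, gradNormSq_fourierTruncate, FunctionSpaces.Torus.fourierTruncate_eq,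
      FunctionSpaces.Torus.toReal_eGradNormSq_realTrigPoly FunctionSpaces.Torus.neg_mem_freqBall_of_mem
        (FunctionSpaces.Torus.isConjSymm_mFourierCoeff hvi)]
    congr 1
    exact Finset.sum_congr rfl fun k _ => by rw [hck k]
  -- ### the tail of the difference against the two tails
  have hPlin : ∀ x, P x = FunctionSpaces.Torus.fourierTruncate N (w s) x - FunctionSpaces.Torus.fourierTruncate N (u s) x := by
    intro x
    have hcf : c = (fun k => mFourierCoeff (FunctionSpaces.EuclideanSpace.complexify ∘ w s) k) -
        (fun k => mFourierCoeff (FunctionSpaces.EuclideanSpace.complexify ∘ u s) k) := by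
      funext k; simp only [Pi.sub_apply, hc]
    rw [hPc, hcf, FunctionSpaces.Torus.realTrigPoly_sub, Pi.sub_apply, FunctionSpaces.Torus.fourierTruncate_eq,
      FunctionSpaces.Torus.fourierTruncate_eq]
  have htail : ∫ x, ‖v x - P x‖ ^ 2 ≤
      2 * (∫ x, ‖w s x - FunctionSpaces.Torus.fourierTruncate N (w s) x‖ ^ 2) +
        2 * ∫ x, ‖u s x - FunctionSpaces.Torus.fourierTruncate N (u s) x‖ ^ 2 := by
    have j1 : Integrable (fun x => ‖w s x - FunctionSpaces.Torus.fourierTruncate N (w s) x‖ ^ 2) volume :=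
      (hm1.sub (FunctionSpaces.Torus.memLp_fourierTruncate N (w s) 2)).integrable_norm_pow two_ne_zero
    have j2 : Integrable (fun x => ‖u s x - FunctionSpaces.Torus.fourierTruncate N (u s) x‖ ^ 2) volume :=
      (hm2.sub (FunctionSpaces.Torus.memLp_fourierTruncate N (u s) 2)).integrable_norm_pow two_ne_zero
    have hpt : ∀ x, ‖v x - P x‖ ^ 2 ≤
        2 * ‖w s x - FunctionSpaces.Torus.fourierTruncate N (w s) x‖ ^ 2 +
          2 * ‖u s x - FunctionSpaces.Torus.fourierTruncate N (u s) x‖ ^ 2 := by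
      intro x
      have e : v x - P x = (w s x - FunctionSpaces.Torus.fourierTruncate N (w s) x) -
          (u s x - FunctionSpaces.Torus.fourierTruncate N (u s) x) := by
        rw [hPlin x, hv]
        beta_reduce
        abel
      rw [e]
      nlinarith [norm_sub_le (w s x - FunctionSpaces.Torus.fourierTruncate N (w s) x)
          (u s x - FunctionSpaces.Torus.fourierTruncate N (u s) x),
        norm_nonneg ((w s x - FunctionSpaces.Torus.fourierTruncate N (w s) x) -
          (u s x - FunctionSpaces.Torus.fourierTruncate N (u s) x)),
        sq_nonneg (‖w s x - FunctionSpaces.Torus.fourierTruncate N (w s) x‖ -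
          ‖u s x - FunctionSpaces.Torus.fourierTruncate N (u s) x‖)]
    calc ∫ x, ‖v x - P x‖ ^ 2
        ≤ ∫ x, (2 * ‖w s x - FunctionSpaces.Torus.fourierTruncate N (w s) x‖ ^ 2 +
            2 * ‖u s x - FunctionSpaces.Torus.fourierTruncate N (u s) x‖ ^ 2) :=
          integral_mono_of_nonneg (ae_of_all _ fun x => sq_nonneg _) ((j1.const_mul 2).add (j2.const_mul 2))
            (ae_of_all _ hpt)
      _ = 2 * (∫ x, ‖w s x - FunctionSpaces.Torus.fourierTruncate N (w s) x‖ ^ 2) +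
            2 * ∫ x, ‖u s x - FunctionSpaces.Torus.fourierTruncate N (u s) x‖ ^ 2 := by
          rw [integral_add (j1.const_mul 2) (j2.const_mul 2), integral_const_mul, integral_const_mul]
  -- ### assemble
  rw [hLHS, hsplit, hrem, ← hgrad]
  refine (add_le_add (le_abs_self _) (le_abs_self _)).trans (add_le_add (hR.trans ?_) hX)
  refine mul_le_mul_of_nonneg_right (mul_le_mul_of_nonneg_left (Real.sqrt_le_sqrt htail) (by positivity))
    (Real.sqrt_nonneg _)

end IsWeakTensorPassiveVectorOn

end StreamEstimate

section StreamMain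

namespace IsWeakTensorPassiveVectorOn

variable {T : ℝ} {𝔸 : Visc4 d} {b b' w u : ℝ → UnitAddTorus d → EuclideanSpace ℝ d}
  {w₀ : UnitAddTorus d → EuclideanSpace ℝ d}

/-- Time-measurability, a.e. finiteness and integrability of the enstrophy `s ↦ ‖∇u(s)‖₂²` of a weak
solution with bounded carrier (finite dissipation). [cite: RobinsonRodrigoSadowski2016, §4.2 (4.20)] -/
theorem enstrophy_time_facts (h₂ : IsWeakTensorPassiveVectorOn 0 T 𝔸 b' w₀ u)
    {lo hi : ℝ} (h𝔸 : NearIso 𝔸 lo hi) (hlo : 0 < lo)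
    (hw₀ : MemLp w₀ 2 volume) (hdiv₀ : FunctionSpaces.Torus.IsWeaklyDivFree w₀)
    (hb' : MemLp (FunctionSpaces.Torus.stLift b') ∞ (volume.restrict (Ioo 0 T ×ˢ univ))) :
    AEMeasurable (fun s => FunctionSpaces.Torus.eGradNormSq (u s)) (volume.restrict (Ioo 0 T)) ∧
    (∫⁻ s in Ioo 0 T, FunctionSpaces.Torus.eGradNormSq (u s)) < ⊤ ∧
    (∀ᵐ s ∂(volume.restrict (Ioo 0 T)), FunctionSpaces.Torus.eGradNormSq (u s) < ⊤) ∧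
    IntegrableOn (fun s => (FunctionSpaces.Torus.eGradNormSq (u s)).toReal) (Ioo 0 T) := by
  have hmeas : AEMeasurable (fun s => FunctionSpaces.Torus.eGradNormSq (u s)) (volume.restrict (Ioo 0 T)) :=
    Torus.aemeasurable_eGradNormSq_of_coeff fun k =>
      Torus.aestronglyMeasurable_mFourierCoeff_complexify_slice h₂.aestronglyMeasurable_uncurry k
  have hDT : eVectorDissipation lo u 0 T < ⊤ := h₂.eVectorDissipation_lt_top h𝔸 hlo hw₀ hdiv₀ hb'
  have hfin : ∫⁻ s in Ioo 0 T, FunctionSpaces.Torus.eGradNormSq (u s) < ⊤ := by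
    unfold eVectorDissipation at hDT
    rcases ENNReal.mul_lt_top_iff.1 hDT with h1 | h1 | h1
    · exact h1.2
    · exact absurd (ENNReal.ofReal_eq_zero.1 h1) (not_le.2 hlo)
    · rw [h1]; exact ENNReal.zero_lt_top
  exact ⟨hmeas, hfin, ae_lt_top' hmeas hfin.ne, integrable_toReal_of_lintegral_ne_top hmeas hfin.ne⟩

set_option maxHeartbeats 800000 in
/-- **Energy-class stability under a stream-potential perturbation of the carrier** (`A = 0`): if
`b − b' = ∇·ψ` in distributions at a.e. time with `ψ` antisymmetric and `|ψᵢₐ| ≤ Λ`, both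
carriers bounded, the datum `w₀ ∈ L²` weakly divergence free and `b' ∈ L^∞`, then for a.e. `t ∈ (0,T)`,
`∫ ‖w(t) − u(t)‖² ≤ (d² Λ² / (2 lo)) ∫_{(0,t]} ‖∇u(s)‖₂² ds`
— the carrier difference enters only through the SIZE OF ITS POTENTIAL `Λ`, with no factor in
`M` and no exponential (antisymmetric transport remainder, potential cross flux
`≤ d Λ ‖∇u‖₂ ‖∇P_N z‖₂` absorbed into the dissipation, `N → ∞`).
[cite: RobinsonRodrigoSadowski2016, §4.2 (4.20)] [cite: DiPernaLions1989, §II.1 Thm. II.1] -/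
theorem ae_integral_norm_sq_sub_le_of_stream (h₁ : IsWeakTensorPassiveVectorOn 0 T 𝔸 b w₀ w)
    (h₂ : IsWeakTensorPassiveVectorOn 0 T 𝔸 b' w₀ u) {lo hi : ℝ} (h𝔸 : NearIso 𝔸 lo hi) (hlo : 0 < lo)
    (hw₀ : MemLp w₀ 2 volume) (hdiv₀ : FunctionSpaces.Torus.IsWeaklyDivFree w₀)
    (hb' : MemLp (FunctionSpaces.Torus.stLift b') ∞ (volume.restrict (Ioo 0 T ×ˢ univ)))
    {M M' : ℝ} (hM : 0 ≤ M) (hM' : 0 ≤ M')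
    (hbM : ∀ᵐ s ∂(volume.restrict (Ioo 0 T)), ∀ᵐ x ∂volume, ‖b s x‖ ≤ M)
    (hbM' : ∀ᵐ s ∂(volume.restrict (Ioo 0 T)), ∀ᵐ x ∂volume, ‖b' s x‖ ≤ M')
    {ψ : ℝ → UnitAddTorus d → d → d → ℝ} (hanti : ∀ s x i a, ψ s x i a = -ψ s x a i) {Λ : ℝ} (hΛ : 0 ≤ Λ)
    (hψΛ : ∀ᵐ s ∂(volume.restrict (Ioo 0 T)), ∀ᵐ x ∂volume, ∀ i a, |ψ s x i a| ≤ Λ)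
    (hψm : ∀ᵐ s ∂(volume.restrict (Ioo 0 T)), ∀ i a, AEStronglyMeasurable (fun x => ψ s x i a) volume)
    (hdivψ : ∀ᵐ s ∂(volume.restrict (Ioo 0 T)), ∀ φ : UnitAddTorus d → ℝ, FunctionSpaces.Torus.IsSmooth φ → ∀ a,
      ∫ x, (b s x a - b' s x a) * φ x = -∫ x, ∑ i, ψ s x i a * FunctionSpaces.Torus.partialDeriv i φ x) :
    ∀ᵐ t ∂(volume.restrict (Ioo 0 T)),
      ∫ x, ‖w t x - u t x‖ ^ 2 ≤
        (Fintype.card d : ℝ) ^ 2 * Λ ^ 2 / (2 * lo) * ∫ s in Ioc 0 t, (FunctionSpaces.Torus.eGradNormSq (u s)).toReal := by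
  classical
  have hw₀i : Integrable w₀ volume := hw₀.integrable one_le_two
  obtain ⟨hDmeas, hDfinT, hDfin, hDui⟩ := enstrophy_time_facts h₂ h𝔸 hlo hw₀ hdiv₀ hb'
  -- ### notation
  set X : (d → ℤ) → ℝ → EuclideanSpace ℂ d := fun k s =>
    mFourierCoeff (FunctionSpaces.EuclideanSpace.complexify ∘ w s) k -
      mFourierCoeff (FunctionSpaces.EuclideanSpace.complexify ∘ u s) k with hX
  set Q : ℕ → ℝ → ℝ := fun N s => 4 * Real.pi ^ 2 * ∑ k ∈ FunctionSpaces.Torus.freqBall N,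
    (⟪X k s, symbT 𝔸 k (X k s)⟫_ℂ).re with hQ
  set Bs : ℕ → ℝ → ℝ := fun N s => ∑ k ∈ FunctionSpaces.Torus.freqBall N,
    ((∑ j, (2 * Real.pi * I * (k j)) *
        ⟪mFourierCoeff (FunctionSpaces.EuclideanSpace.complexify ∘ fun x => b s x j • w s x) k -
          mFourierCoeff (FunctionSpaces.EuclideanSpace.complexify ∘ fun x => b' s x j • u s x) k, X k s⟫_ℂ) +
      ((0 : ℝ) : ℂ) * ∑ j, (2 * Real.pi * I * (k j)) *
        ⟪mFourierCoeff (FunctionSpaces.EuclideanSpace.complexify ∘ fun x => w s x j • b s x) k -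
          mFourierCoeff (FunctionSpaces.EuclideanSpace.complexify ∘ fun x => u s x j • b' s x) k, X k s⟫_ℂ).re with hBs
  set g : ℕ → ℝ → ℝ := fun N s => 4 * Real.pi ^ 2 * ∑ k ∈ FunctionSpaces.Torus.freqBall N,
    FunctionSpaces.Torus.freqNormSq k * ‖X k s‖ ^ 2 with hg
  set f : ℕ → ℝ → ℝ := fun N s =>
    2 * (∫ x, ‖w s x - FunctionSpaces.Torus.fourierTruncate N (w s) x‖ ^ 2) +
      2 * ∫ x, ‖u s x - FunctionSpaces.Torus.fourierTruncate N (u s) x‖ ^ 2 with hf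
  set Du : ℝ → ℝ := fun s => (FunctionSpaces.Torus.eGradNormSq (u s)).toReal with hDu
  set C₁ : ℝ := Fintype.card d * M with hC₁
  set C₂ : ℝ := Fintype.card d * Λ with hC₂
  have hC₁0 : 0 ≤ C₁ := by positivity
  have hC₂0 : 0 ≤ C₂ := by positivity
  have hf0 : ∀ N s, 0 ≤ f N s := fun N s =>
    add_nonneg (mul_nonneg two_pos.le (integral_nonneg fun x => sq_nonneg _))
      (mul_nonneg two_pos.le (integral_nonneg fun x => sq_nonneg _))
  have hg0 : ∀ N s, 0 ≤ g N s := fun N s => mul_nonneg (by positivity)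
    (Finset.sum_nonneg fun k _ => mul_nonneg (FunctionSpaces.Torus.freqNormSq_nonneg k) (sq_nonneg _))
  have hDu0 : ∀ s, 0 ≤ Du s := fun s => ENNReal.toReal_nonneg
  -- ### the three a.e. inputs
  have hId : ∀ᵐ t ∂(volume.restrict (Ioo 0 T)), ∀ N,
      (∑ k ∈ FunctionSpaces.Torus.freqBall N, ‖X k t‖ ^ 2) + 2 * ∫ s in Ioc 0 t, Q N s = 2 * ∫ s in Ioc 0 t, Bs N s :=
    ae_sum_sq_norm_sub_eq h₁ h₂ hw₀i
  have hflux : ∀ᵐ s ∂(volume.restrict (Ioo 0 T)), ∀ N,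
      Bs N s ≤ C₁ * Real.sqrt (f N s) * Real.sqrt (g N s) + C₂ * Real.sqrt (Du s) * Real.sqrt (g N s) :=
    ae_fluxSum_sub_le_stream h₁ h₂ hM hM' hbM hbM' hanti hΛ hψΛ hψm hdivψ hDfin
  have hcoer : ∀ᵐ s ∂(volume.restrict (Ioo 0 T)), ∀ N, lo * g N s ≤ Q N s :=
    ae_lo_mul_gradSum_sub_le h₁ h₂ h𝔸
  -- ### integrability on `(0,T)`
  have hBsi : ∀ N, IntegrableOn (Bs N) (Ioo 0 T) := fun N => by
    have h := integrable_finsetSum (FunctionSpaces.Torus.freqBall N) fun k _ => (integrableOn_fluxRHS_sub h₁ h₂ k).re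
    exact h.congr (ae_of_all _ fun s => rfl)
  have hQi : ∀ N, IntegrableOn (Q N) (Ioo 0 T) := fun N =>
    (integrable_finsetSum (FunctionSpaces.Torus.freqBall N) fun k _ => (integrableOn_inner_symbT_sub h₁ h₂ k).re).const_mul _
  have hgi : ∀ N, IntegrableOn (g N) (Ioo 0 T) := fun N => integrableOn_gradSum_sub h₁ h₂ N
  obtain ⟨htwi, -, -⟩ := h₁.galerkin_tail
  obtain ⟨htui, -, -⟩ := h₂.galerkin_tail
  have hfi : ∀ N, IntegrableOn (f N) (Ioo 0 T) := fun N => ((htwi N).const_mul 2).add ((htui N).const_mul 2)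
  -- ### the tails vanish in `L¹(0,T)`
  have hft : Tendsto (fun N => ∫ s in Ioo 0 T, f N s) atTop (𝓝 0) := by
    have h1 := h₁.tendsto_integral_galerkin_tail
    have h2 := h₂.tendsto_integral_galerkin_tail
    have h := (h1.const_mul 2).add (h2.const_mul 2)
    rw [mul_zero, add_zero] at h
    refine h.congr fun N => ?_
    rw [hf]
    simp only
    rw [integral_add ((htwi N).const_mul 2) ((htui N).const_mul 2), integral_const_mul, integral_const_mul]
  -- ### conclude at a.e. `t`
  filter_upwards [hId, h₁.ae_memLp_two, h₂.ae_memLp_two, h₁.ae_integrable_slice, h₂.ae_integrable_slice,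
    ae_restrict_mem measurableSet_Ioo] with t ht hm1 hm2 hs1 hs2 htT
  have hsub : Ioc 0 t ⊆ Ioo 0 T := Ioc_subset_Ioo_right htT.2
  set E : ℝ := ∫ s in Ioc 0 t, Du s with hE
  have hE0 : 0 ≤ E := setIntegral_nonneg measurableSet_Ioc fun s _ => hDu0 s
  -- the bound for every `N`
  have hSN : ∀ N, ∑ k ∈ FunctionSpaces.Torus.freqBall N, ‖X k t‖ ^ 2 ≤
      (C₁ * Real.sqrt (∫ s in Ioo 0 T, f N s) + C₂ * Real.sqrt E) ^ 2 / (2 * lo) := by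
    intro N
    set G : ℝ := ∫ s in Ioc 0 t, g N s with hG
    have hG0 : 0 ≤ G := setIntegral_nonneg measurableSet_Ioc fun s _ => hg0 N s
    have hQG : lo * G ≤ ∫ s in Ioc 0 t, Q N s := by
      rw [hG, ← integral_const_mul]
      exact integral_mono_ae (IntegrableOn.mono_set ((hgi N).const_mul lo) hsub) ((hQi N).mono_set hsub)
        (ae_restrict_of_ae_restrict_of_subset hsub (hcoer.mono fun s hs => hs N))
    have hsfg' : IntegrableOn (fun s => Real.sqrt (f N s) * Real.sqrt (g N s)) (Ioo 0 T) :=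
      integrable_sqrt_mul_sqrt₈ (hfi N) (hgi N) (hf0 N) (hg0 N)
    have hsfg : IntegrableOn (fun s => Real.sqrt (f N s) * Real.sqrt (g N s)) (Ioc 0 t) := hsfg'.mono_set hsub
    have hseg' : IntegrableOn (fun s => Real.sqrt (Du s) * Real.sqrt (g N s)) (Ioo 0 T) :=
      integrable_sqrt_mul_sqrt₈ hDui (hgi N) hDu0 (hg0 N)
    have hseg : IntegrableOn (fun s => Real.sqrt (Du s) * Real.sqrt (g N s)) (Ioc 0 t) := hseg'.mono_set hsub
    have hBa : ∫ s in Ioc 0 t, Bs N s ≤ (C₁ * Real.sqrt (∫ s in Ioo 0 T, f N s) + C₂ * Real.sqrt E) * Real.sqrt G := by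
      calc ∫ s in Ioc 0 t, Bs N s
          ≤ ∫ s in Ioc 0 t, (C₁ * (Real.sqrt (f N s) * Real.sqrt (g N s)) + C₂ * (Real.sqrt (Du s) * Real.sqrt (g N s))) := by
            refine integral_mono_ae ((hBsi N).mono_set hsub) ((hsfg.const_mul C₁).add (hseg.const_mul C₂)) ?_
            refine ae_restrict_of_ae_restrict_of_subset hsub (hflux.mono fun s hs => ?_)
            have h := hs N
            calc Bs N s ≤ C₁ * Real.sqrt (f N s) * Real.sqrt (g N s) + C₂ * Real.sqrt (Du s) * Real.sqrt (g N s) := h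
              _ = C₁ * (Real.sqrt (f N s) * Real.sqrt (g N s)) + C₂ * (Real.sqrt (Du s) * Real.sqrt (g N s)) := by ring
        _ = C₁ * (∫ s in Ioc 0 t, Real.sqrt (f N s) * Real.sqrt (g N s)) +
              C₂ * ∫ s in Ioc 0 t, Real.sqrt (Du s) * Real.sqrt (g N s) := by
            rw [integral_add (hsfg.const_mul C₁) (hseg.const_mul C₂), integral_const_mul, integral_const_mul]
        _ ≤ C₁ * (Real.sqrt (∫ s in Ioc 0 t, f N s) * Real.sqrt G) + C₂ * (Real.sqrt E * Real.sqrt G) := by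
            refine add_le_add (mul_le_mul_of_nonneg_left ?_ hC₁0) (mul_le_mul_of_nonneg_left ?_ hC₂0)
            · exact integral_sqrt_mul_sqrt_le₈ ((hfi N).mono_set hsub) ((hgi N).mono_set hsub)
                (ae_of_all _ fun s => hf0 N s) (ae_of_all _ fun s => hg0 N s)
            · exact integral_sqrt_mul_sqrt_le₈ (hDui.mono_set hsub) ((hgi N).mono_set hsub)
                (ae_of_all _ fun s => hDu0 s) (ae_of_all _ fun s => hg0 N s)
        _ ≤ C₁ * (Real.sqrt (∫ s in Ioo 0 T, f N s) * Real.sqrt G) + C₂ * (Real.sqrt E * Real.sqrt G) := by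
            refine add_le_add (mul_le_mul_of_nonneg_left (mul_le_mul_of_nonneg_right (Real.sqrt_le_sqrt ?_)
              (Real.sqrt_nonneg _)) hC₁0) le_rfl
            exact setIntegral_mono_set (hfi N) (ae_of_all _ fun s => hf0 N s) hsub.eventuallyLE
        _ = (C₁ * Real.sqrt (∫ s in Ioo 0 T, f N s) + C₂ * Real.sqrt E) * Real.sqrt G := by ring
    have hmain : (∑ k ∈ FunctionSpaces.Torus.freqBall N, ‖X k t‖ ^ 2) + 2 * lo * G ≤
        2 * (C₁ * Real.sqrt (∫ s in Ioo 0 T, f N s) + C₂ * Real.sqrt E) * Real.sqrt G := by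
      have h := ht N
      nlinarith [h, hQG, hBa]
    exact le_of_absorb₈ hlo hG0 hmain
  -- ### the limit `N → ∞`
  have hz2 : MemLp (fun x => w t x - u t x) 2 volume := hm1.sub hm2
  have hck : ∀ k, mFourierCoeff (FunctionSpaces.EuclideanSpace.complexify ∘ fun x => w t x - u t x) k = X k t := by
    intro k
    rw [show (fun x => w t x - u t x) = w t - u t from rfl, FunctionSpaces.Torus.complexify_comp_sub,
      FunctionSpaces.Torus.mFourierCoeff_sub (FunctionSpaces.Torus.integrable_complexify_comp hs1.1)
        (FunctionSpaces.Torus.integrable_complexify_comp hs2.1)]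
  have hS : Tendsto (fun N => ∑ k ∈ FunctionSpaces.Torus.freqBall N, ‖X k t‖ ^ 2) atTop (𝓝 (∫ x, ‖w t x - u t x‖ ^ 2)) := by
    have h := (FunctionSpaces.Torus.hasSum_sq_norm_mFourierCoeff_complexify hz2).comp FunctionSpaces.Torus.tendsto_freqBall_atTop
    refine h.congr fun N => ?_
    refine Finset.sum_congr rfl fun k _ => ?_
    dsimp only
    rw [hck k]
  have hR : Tendsto (fun N => (C₁ * Real.sqrt (∫ s in Ioo 0 T, f N s) + C₂ * Real.sqrt E) ^ 2 / (2 * lo)) atTop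
      (𝓝 ((C₁ * Real.sqrt 0 + C₂ * Real.sqrt E) ^ 2 / (2 * lo))) :=
    ((((Real.continuous_sqrt.tendsto 0).comp hft).const_mul C₁).add tendsto_const_nhds).pow 2 |>.div_const _
  have hlim := le_of_tendsto_of_tendsto' hS hR hSN
  rw [Real.sqrt_zero, mul_zero, zero_add, mul_pow, Real.sq_sqrt hE0, hC₂, mul_pow] at hlim
  calc ∫ x, ‖w t x - u t x‖ ^ 2 ≤ (Fintype.card d : ℝ) ^ 2 * Λ ^ 2 * E / (2 * lo) := hlim
    _ = (Fintype.card d : ℝ) ^ 2 * Λ ^ 2 / (2 * lo) * E := by ring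

/-- **Energy-class stability under a stream-potential perturbation, against the datum energy**
(`A = 0`): with the hypotheses of `ae_integral_norm_sq_sub_le_of_stream`, for a.e. `t ∈ (0,T)`,
`∫ ‖w(t) − u(t)‖² ≤ (d² Λ² / (4 lo²)) ∫ ‖w₀‖²`
(`2 lo ∫₀ᵗ ‖∇u‖₂² ≤ ∫‖w₀‖²`, the energy inequality of `u`). The smallness ratio is `(Λ / lo)²` —
in the K1L tail step `Λ = ‖ψ_{>j}‖_∞`, `lo = kbar_j`.
[cite: RobinsonRodrigoSadowski2016, §4.2 (4.20)] [cite: DiPernaLions1989, §II.1 Thm. II.1] -/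
theorem ae_integral_norm_sq_sub_le_of_stream_datum (h₁ : IsWeakTensorPassiveVectorOn 0 T 𝔸 b w₀ w)
    (h₂ : IsWeakTensorPassiveVectorOn 0 T 𝔸 b' w₀ u) {lo hi : ℝ} (h𝔸 : NearIso 𝔸 lo hi) (hlo : 0 < lo)
    (hw₀ : MemLp w₀ 2 volume) (hdiv₀ : FunctionSpaces.Torus.IsWeaklyDivFree w₀)
    (hb' : MemLp (FunctionSpaces.Torus.stLift b') ∞ (volume.restrict (Ioo 0 T ×ˢ univ)))
    {M M' : ℝ} (hM : 0 ≤ M) (hM' : 0 ≤ M')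
    (hbM : ∀ᵐ s ∂(volume.restrict (Ioo 0 T)), ∀ᵐ x ∂volume, ‖b s x‖ ≤ M)
    (hbM' : ∀ᵐ s ∂(volume.restrict (Ioo 0 T)), ∀ᵐ x ∂volume, ‖b' s x‖ ≤ M')
    {ψ : ℝ → UnitAddTorus d → d → d → ℝ} (hanti : ∀ s x i a, ψ s x i a = -ψ s x a i) {Λ : ℝ} (hΛ : 0 ≤ Λ)
    (hψΛ : ∀ᵐ s ∂(volume.restrict (Ioo 0 T)), ∀ᵐ x ∂volume, ∀ i a, |ψ s x i a| ≤ Λ)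
    (hψm : ∀ᵐ s ∂(volume.restrict (Ioo 0 T)), ∀ i a, AEStronglyMeasurable (fun x => ψ s x i a) volume)
    (hdivψ : ∀ᵐ s ∂(volume.restrict (Ioo 0 T)), ∀ φ : UnitAddTorus d → ℝ, FunctionSpaces.Torus.IsSmooth φ → ∀ a,
      ∫ x, (b s x a - b' s x a) * φ x = -∫ x, ∑ i, ψ s x i a * FunctionSpaces.Torus.partialDeriv i φ x) :
    ∀ᵐ t ∂(volume.restrict (Ioo 0 T)),
      ∫ x, ‖w t x - u t x‖ ^ 2 ≤ (Fintype.card d : ℝ) ^ 2 * Λ ^ 2 / (4 * lo ^ 2) * ∫ x, ‖w₀ x‖ ^ 2 := by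
  have hmain := ae_integral_norm_sq_sub_le_of_stream h₁ h₂ h𝔸 hlo hw₀ hdiv₀ hb' hM hM' hbM hbM' hanti hΛ hψΛ hψm hdivψ
  obtain ⟨hDmeas, hDfinT, hDfin, hDui⟩ := enstrophy_time_facts h₂ h𝔸 hlo hw₀ hdiv₀ hb'
  have hDfin' : ∀ᵐ s ∂(volume : Measure ℝ), s ∈ Ioo 0 T → FunctionSpaces.Torus.eGradNormSq (u s) < ⊤ :=
    (ae_restrict_iff' measurableSet_Ioo).1 hDfin
  have hE0 : 0 ≤ ∫ x, ‖w₀ x‖ ^ 2 := integral_nonneg fun x => sq_nonneg _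
  filter_upwards [hmain, h₂.ae_energy_ineq h𝔸 hlo hw₀ hdiv₀ hb', ae_restrict_mem measurableSet_Ioo] with t ht hen htT
  have hsub : Ioc 0 t ⊆ Ioo 0 T := Ioc_subset_Ioo_right htT.2
  -- the time integral of the enstrophy against the datum energy
  set L : ℝ≥0∞ := ∫⁻ s in Ioo 0 t, FunctionSpaces.Torus.eGradNormSq (u s) with hL
  have hLfin : L ≠ ⊤ := (lt_of_le_of_lt (lintegral_mono_set (Ioo_subset_Ioo_right htT.2.le)) hDfinT).ne
  have hLreal : ∫ s in Ioc 0 t, (FunctionSpaces.Torus.eGradNormSq (u s)).toReal = L.toReal := by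
    rw [hL, setLIntegral_congr (Ioo_ae_eq_Ioc (μ := (volume : Measure ℝ)))]
    refine integral_toReal (hDmeas.mono_measure (Measure.restrict_mono hsub le_rfl)) ?_
    exact (ae_restrict_iff' measurableSet_Ioc).2 (hDfin'.mono fun s hs hsI => hs (hsub hsI))
  have hLle : L.toReal ≤ (∫ x, ‖w₀ x‖ ^ 2) / (2 * lo) := by
    have h1 : 2 * (ENNReal.ofReal lo * L) ≤ ENNReal.ofReal (∫ x, ‖w₀ x‖ ^ 2) := by
      have := hen
      unfold eVectorDissipation at this
      exact le_trans le_add_self this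
    have h2 : (2 * (ENNReal.ofReal lo * L)).toReal ≤ (ENNReal.ofReal (∫ x, ‖w₀ x‖ ^ 2)).toReal :=
      ENNReal.toReal_mono ENNReal.ofReal_ne_top h1
    rw [ENNReal.toReal_mul, ENNReal.toReal_mul, ENNReal.toReal_ofNat, ENNReal.toReal_ofReal hlo.le,
      ENNReal.toReal_ofReal hE0] at h2
    rw [le_div_iff₀ (by positivity)]
    nlinarith [h2]
  calc ∫ x, ‖w t x - u t x‖ ^ 2
      ≤ (Fintype.card d : ℝ) ^ 2 * Λ ^ 2 / (2 * lo) * ∫ s in Ioc 0 t, (FunctionSpaces.Torus.eGradNormSq (u s)).toReal := ht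
    _ ≤ (Fintype.card d : ℝ) ^ 2 * Λ ^ 2 / (2 * lo) * ((∫ x, ‖w₀ x‖ ^ 2) / (2 * lo)) := by
        rw [hLreal]
        exact mul_le_mul_of_nonneg_left hLle (by positivity)
    _ = (Fintype.card d : ℝ) ^ 2 * Λ ^ 2 / (4 * lo ^ 2) * ∫ x, ‖w₀ x‖ ^ 2 := by
        field_simp
        ring

/-- **The drop form of the stream-potential stability** (`A = 0`): for a.e. `t ∈ (0,T)`,
`∫ ‖w(t)‖² ≤ ∫ ‖u(t)‖² + (2η + η²) ∫ ‖w₀‖²`, `η² = d² Λ² / (4 lo²)`; in the K1L tail step,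
`drop w₀ u t ≤ drop w₀ w t + (2η + η²)‖w₀‖²` with `η = d ‖ψ_{>j}‖_∞ / (2 kbar_j)`.
[cite: RobinsonRodrigoSadowski2016, §4.2 (4.20)] [cite: DiPernaLions1989, §II.1 Thm. II.1] -/
theorem ae_integral_norm_sq_le_add_of_stream (h₁ : IsWeakTensorPassiveVectorOn 0 T 𝔸 b w₀ w)
    (h₂ : IsWeakTensorPassiveVectorOn 0 T 𝔸 b' w₀ u) {lo hi : ℝ} (h𝔸 : NearIso 𝔸 lo hi) (hlo : 0 < lo)
    (hw₀ : MemLp w₀ 2 volume) (hdiv₀ : FunctionSpaces.Torus.IsWeaklyDivFree w₀)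
    (hb' : MemLp (FunctionSpaces.Torus.stLift b') ∞ (volume.restrict (Ioo 0 T ×ˢ univ)))
    {M M' : ℝ} (hM : 0 ≤ M) (hM' : 0 ≤ M')
    (hbM : ∀ᵐ s ∂(volume.restrict (Ioo 0 T)), ∀ᵐ x ∂volume, ‖b s x‖ ≤ M)
    (hbM' : ∀ᵐ s ∂(volume.restrict (Ioo 0 T)), ∀ᵐ x ∂volume, ‖b' s x‖ ≤ M')
    {ψ : ℝ → UnitAddTorus d → d → d → ℝ} (hanti : ∀ s x i a, ψ s x i a = -ψ s x a i) {Λ : ℝ} (hΛ : 0 ≤ Λ)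
    (hψΛ : ∀ᵐ s ∂(volume.restrict (Ioo 0 T)), ∀ᵐ x ∂volume, ∀ i a, |ψ s x i a| ≤ Λ)
    (hψm : ∀ᵐ s ∂(volume.restrict (Ioo 0 T)), ∀ i a, AEStronglyMeasurable (fun x => ψ s x i a) volume)
    (hdivψ : ∀ᵐ s ∂(volume.restrict (Ioo 0 T)), ∀ φ : UnitAddTorus d → ℝ, FunctionSpaces.Torus.IsSmooth φ → ∀ a,
      ∫ x, (b s x a - b' s x a) * φ x = -∫ x, ∑ i, ψ s x i a * FunctionSpaces.Torus.partialDeriv i φ x) :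
    ∀ᵐ t ∂(volume.restrict (Ioo 0 T)),
      ∫ x, ‖w t x‖ ^ 2 ≤ (∫ x, ‖u t x‖ ^ 2) +
        (2 * Real.sqrt ((Fintype.card d : ℝ) ^ 2 * Λ ^ 2 / (4 * lo ^ 2)) +
          (Fintype.card d : ℝ) ^ 2 * Λ ^ 2 / (4 * lo ^ 2)) * ∫ x, ‖w₀ x‖ ^ 2 := by
  have hmain := ae_integral_norm_sq_sub_le_of_stream_datum h₁ h₂ h𝔸 hlo hw₀ hdiv₀ hb' hM hM' hbM hbM' hanti hΛ hψΛ hψm hdivψ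
  have hen : ∀ᵐ s ∂(volume.restrict (Ioo 0 T)), ∫ x, ‖u s x‖ ^ 2 ≤ ∫ x, ‖w₀ x‖ ^ 2 := by
    filter_upwards [h₂.ae_energy_ineq h𝔸 hlo hw₀ hdiv₀ hb'] with s hs
    have h1 : ENNReal.ofReal (∫ x, ‖u s x‖ ^ 2) ≤ ENNReal.ofReal (∫ x, ‖w₀ x‖ ^ 2) := le_trans le_self_add hs
    exact (ENNReal.ofReal_le_ofReal_iff (integral_nonneg fun x => sq_nonneg _)).1 h1
  filter_upwards [hmain, hen, h₁.ae_memLp_two, h₂.ae_memLp_two] with t ht hB hm1 hm2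
  -- names
  set E₀ : ℝ := ∫ x, ‖w₀ x‖ ^ 2 with hE₀
  set η2 : ℝ := (Fintype.card d : ℝ) ^ 2 * Λ ^ 2 / (4 * lo ^ 2) with hη2
  set B : ℝ := ∫ x, ‖u t x‖ ^ 2 with hBdef
  set Z : ℝ := ∫ x, ‖w t x - u t x‖ ^ 2 with hZ
  have hE0 : 0 ≤ E₀ := integral_nonneg fun x => sq_nonneg _
  have hη0 : 0 ≤ η2 := by rw [hη2]; positivity
  have hz2 : MemLp (fun x => w t x - u t x) 2 volume := hm1.sub hm2
  have iB := hm2.integrable_norm_pow two_ne_zero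
  have iZ : Integrable (fun x => ‖w t x - u t x‖ ^ 2) volume := hz2.integrable_norm_pow two_ne_zero
  have iP : Integrable (fun x => ‖u t x‖ * ‖w t x - u t x‖) volume := hm2.norm.integrable_mul hz2.norm
  have iI : Integrable (fun x => ⟪u t x, w t x - u t x⟫_ℝ) volume :=
    Integrable.mono' iP (hm2.1.inner hz2.1) (ae_of_all _ fun x => by
      rw [Real.norm_eq_abs]; exact abs_real_inner_le_norm (u t x) (w t x - u t x))
  have hexp : ∫ x, ‖w t x‖ ^ 2 = B + 2 * (∫ x, ⟪u t x, w t x - u t x⟫_ℝ) + Z := by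
    have hpt : ∀ x, ‖w t x‖ ^ 2 = ‖u t x‖ ^ 2 + 2 * ⟪u t x, w t x - u t x⟫_ℝ + ‖w t x - u t x‖ ^ 2 := by
      intro x
      have e : w t x = u t x + (w t x - u t x) := by abel
      conv_lhs => rw [e]
      rw [norm_add_sq_real]
    have iBI : Integrable (fun x => ‖u t x‖ ^ 2 + 2 * ⟪u t x, w t x - u t x⟫_ℝ) volume := iB.add (iI.const_mul 2)
    simp_rw [hpt]
    rw [integral_add iBI iZ, integral_add iB (iI.const_mul 2), integral_const_mul]
  have hCS : ∫ x, ⟪u t x, w t x - u t x⟫_ℝ ≤ Real.sqrt B * Real.sqrt Z :=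
    (le_abs_self _).trans (abs_integral_inner_le_sqrt_mul_sqrt₈ hm2 hz2)
  have hZle : Z ≤ η2 * E₀ := ht
  have hsB : Real.sqrt B ≤ Real.sqrt E₀ := Real.sqrt_le_sqrt hB
  have hsZ : Real.sqrt Z ≤ Real.sqrt η2 * Real.sqrt E₀ := by
    rw [← Real.sqrt_mul hη0]
    exact Real.sqrt_le_sqrt hZle
  have hprod : Real.sqrt B * Real.sqrt Z ≤ Real.sqrt η2 * E₀ := by
    calc Real.sqrt B * Real.sqrt Z ≤ Real.sqrt E₀ * (Real.sqrt η2 * Real.sqrt E₀) :=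
          mul_le_mul hsB hsZ (Real.sqrt_nonneg _) (Real.sqrt_nonneg _)
      _ = Real.sqrt η2 * (Real.sqrt E₀ * Real.sqrt E₀) := by ring
      _ = Real.sqrt η2 * E₀ := by rw [Real.mul_self_sqrt hE0]
  rw [hexp]
  nlinarith [hCS, hprod, hZle]

end IsWeakTensorPassiveVectorOn

end StreamMain

end Torus

end Literature.Analysis.FluidPDE

end
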